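import Summits.MatrixMultiplication.OmegaCensus.DominoZ17StructSixArrA1
import Summits.MatrixMultiplication.OmegaCensus.DominoZ17StructSixArrA2
import Summits.MatrixMultiplication.OmegaCensus.DominoZ17StructSixArrA3
import Summits.MatrixMultiplication.OmegaCensus.DominoZ17StructSixArrA4
import Summits.MatrixMultiplication.OmegaCensus.DominoZ17StructSixArrA5
import Summits.MatrixMultiplication.OmegaCensus.DominoZ17StructSixArrA6
import HarnessLib

/-!
# The `y`-arrangement list of family `A` for the structural part-`6` route, `p = 17`: assembly

ω-census `pub-omega`, family (b3), seat pub-omega-group gen 25.  Framing: lottery ticket; floor = certified bounds/negative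
ranges.  VALUE: per-prime kernel data of the structural part-`6` route WITHOUT the pigeonhole (`DominoZpZpStructSixWide*.lean`)
for `p = 17` — target: the OPEN census cell `(1,6,16)@289` (`A = ℤ₁₇²`) and every larger order with such a quotient; NOT progress on ω.

`hysaZ17s6` (hypothesis `hYSa` of `exists_entry_structSixWide_of_checks`) from the per-representative decides.
-/

namespace Summit.MatrixMultiplication.OmegaCensus

open ZpZpDomino

namespace ZpZpDomino

/-- **Completeness of `ysaZ17s6`**: every `arr6Y3`-arrangement of every representative is listed. [folklore] -/
theorem hysaZ17s6 : ∀ k ∈ rZ17s6, ∀ ys ∈ arr6Y3 17 k, ys ∈ ysaZ17s6 := by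
  have h : ∀ k ∈ rZ17s6, ((arr6Y3 17 k).all fun ys => ysaZ17s6.contains ys) = true := by
    simp only [rZ17s6, List.forall_mem_cons]
    exact ⟨ysaZ17s6_c0, ysaZ17s6_c1, ysaZ17s6_c2, ysaZ17s6_c3, ysaZ17s6_c4, ysaZ17s6_c5, ysaZ17s6_c6, ysaZ17s6_c7, ysaZ17s6_c8, ysaZ17s6_c9, ysaZ17s6_c10, ysaZ17s6_c11, ysaZ17s6_c12, ysaZ17s6_c13, ysaZ17s6_c14, ysaZ17s6_c15, ysaZ17s6_c16, ysaZ17s6_c17, ysaZ17s6_c18, ysaZ17s6_c19, ysaZ17s6_c20, ysaZ17s6_c21, ysaZ17s6_c22, ysaZ17s6_c23, ysaZ17s6_c24, ysaZ17s6_c25, ysaZ17s6_c26, ysaZ17s6_c27, ysaZ17s6_c28, ysaZ17s6_c29, ysaZ17s6_c30, ysaZ17s6_c31, ysaZ17s6_c32, ysaZ17s6_c33, ysaZ17s6_c34, ysaZ17s6_c35, ysaZ17s6_c36, ysaZ17s6_c37, ysaZ17s6_c38, ysaZ17s6_c39, ysaZ17s6_c40, ysaZ17s6_c41, ysaZ17s6_c42,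 ysaZ17s6_c43, ysaZ17s6_c44, ysaZ17s6_c45, ysaZ17s6_c46, ysaZ17s6_c47, ysaZ17s6_c48, ysaZ17s6_c49, ysaZ17s6_c50, ysaZ17s6_c51, ysaZ17s6_c52, ysaZ17s6_c53, ysaZ17s6_c54, ysaZ17s6_c55, ysaZ17s6_c56, ysaZ17s6_c57, ysaZ17s6_c58, ysaZ17s6_c59, ysaZ17s6_c60, ysaZ17s6_c61, ysaZ17s6_c62, ysaZ17s6_c63, ysaZ17s6_c64, ysaZ17s6_c65, ysaZ17s6_c66, ysaZ17s6_c67, ysaZ17s6_c68, fun _ h => (List.not_mem_nil h).elim⟩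
  intro k hk ys hys
  have := List.all_eq_true.1 (h k hk) ys hys
  rwa [List.contains_iff_mem] at this

end ZpZpDomino

end Summit.MatrixMultiplication.OmegaCensus
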